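import Summits.QuantumFields.YangMills.Theorems.BalabanUVNodesN18AtRecordOfKernelLetters
import Summits.QuantumFields.YangMills.Theorems.BalabanUVNodesN18AtU3OfKernels
import Summits.QuantumFields.YangMills.Theorems.BalabanUVNodesD4KernelDecayOfWindowed

/-!
# BalabanUVNodes ∕ N18 — TWO JUNCTIONS IN THE DEFINERS' LETTER CURRENCY (W1-19b `Node00/U3KernelLetters`):
# (J1) THE N18 LETTER FROM ONE MEMBER + NODE N22's WINDOWED LETTERS (family reduction `…N18AtU3OfKernels` ∘ dag-n22-w3's (1.21) passage);
# (J2) THE N18 LETTER + A UNIFORM WINDOWED (5.10) DECAY ⟹ NODE N17's SCALE-SHIFT RATE OF THE MERGED β (`…N18KernelStepRateBoxes` ∘ n17-a's kernel road)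
# — generic term family and AT THE RECORD (Track A, DAG node N18 = NE5; cluster K4 «SpineRates»; key K3⁷ `SpineGivenEndpointR13SepCoPH`, skeleton v3)

HONEST FRAMING.  Count-neutral kernel bookkeeping (seat `pub-ymgap-dag-n18-w1` g2; `--supports stmt-QuantumFields-20544`, helper lane), LOCATED: every input is a
DISPLAY LETTER (`PolLimitsExist(OfRecord₁₃)`, `WindowedNE9(OfRecord₁₃)`, `KernelStepRate(OfRecord₁₃)`) or a displayed hypothesis of the same kind (the ONE-MEMBER
kernel step rate; the UNIFORM windowed (5.10) decay — W1-19b's `WindowedDecay` carries one constant PER coupling sequence, which does NOT serve n17-a's `hU`: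
said here, and the uniform form displayed inline); nothing of Bałaban's is asserted; NE5 ∕ NE9 ∕ NE4 NOT PRINTED as such ∕ NOT proved; N18 ∕ N17 ∕ N22 NOT
discharged; K3⁷ OPEN, not claimed; counts unmoved.  One finite four-torus programme at fixed ε — R4 closes the conditional rung `BalabanLadder.UV` only;
nothing continuum ∕ ℝ⁴ ∕ OS ∕ mass gap ∕ Clay.  THEOREMS ONLY: 0 `def`, 0 `sorry`, standard axioms.

WHAT.
* §1 (J1) `kernelStepRate_of_member_of_windowedNE9` — `PolLimitsExist … (Window γ)` ∧ `WindowedNE9 … (Window γ) κ Λ` ∧ `FadingMemory C₉ ω Λ` ∧ `0 ≤ ω ≤ θ ≤ 1` ∧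
  the kernel step rate at ONE member `b₀ ∈ ]0, γ]` with constant `C₅` ⟹ `KernelStepRate … γ κ θ (C₅ + C₉γ)` (dag-n22-w3's `ne9_EA_of_windowed` then this seat's
  `kernelStepRate_family_of_member`); record edition `kernelStepRateOfRecord₁₃_of_member_of_windowedNE9OfRecord₁₃` (letters `PolLimitsExistOfRecord₁₃`,
  `WindowedNE9OfRecord₁₃ F N θ ℓ.κ ℓ.moduli`, signs `ℓ.Signs`, `ℓ.ω ≤ ℓ.θ₅`, member constant `ℓ.C₅ − ℓ.C₉·θ.γ` ⟹ `KernelStepRateOfRecord₁₃ F N θ ℓ.κ ℓ.θ₅ ℓ.C₅`), and its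
  pin form `n18At_rateCarriers_of_kernels_pin_of_member_of_windowedNE9` (the N18 conjunct at EVERY run length of a pinned reading).
* §2 (J2) `decayBound_EA_of_windowedUniform` — `PolLimitsExist … W` ∧ a UNIFORM windowed (5.10) decay (`|Π^{(K)}_{k+1,μν}(g;z)| ≤ E₀e^{−δ|z|₁}` eventually in `K`,
  ONE `E₀` for all `g ∈ W`, `k`, `μ ν`) ⟹ node U3's own decay slot `DecayBound (EA …) W E₀ δ` (dag-n22-w3's `decay510_kernelA_of_windowed` per entry + W1-19's
  `decayBound_EA_iff`); ★ `scaleShiftRate_betaMerged_of_kernelStepRate_of_windowedUniform` — `KernelStepRate … θ.γ ℓ.κ ℓ.θ₅ ℓ.C₅` ∧ `0 < ℓ.κ` ∧ `PolLimitsExist …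
  (Window θ.γ)` ∧ uniform windowed decay (`0 < δ`) ⟹ `ScaleShiftRate (betaPrime510 4 (ℓ.C₅·ℓ.θ₅) ℓ.κ) ℓ.θ₅ θ.γ (betaMerged F ℰ ρ bV)` (this seat's
  `scaleShiftRate_betaMerged_of_n18At_objects_of_decayBound`); record edition `scaleShiftRate_betaMergedOfRecord_of_letters` (the merged β of record).
So at the kernel reading of record the three K4 rows N18 ∕ N22 ∕ N17(rate half) are chained BY NAME in letter currency:
{one member, `WindowedNE9OfRecord₁₃`, `PolLimitsExistOfRecord₁₃`} ⟹ `KernelStepRateOfRecord₁₃` ⟹ (with a uniform windowed decay) N17's scale-shift rate of the merged β of record.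

Sources (types only): T. Bałaban, CMP **109** (1987) [Balaban1987RG1] Thm 1 p. 259, (1.18) p. 263, (1.20)–(1.22) p. 264, (1.6) p. 261, (5.10) p. 293, §5 p. 298.
Nothing here is a claim about the Yang–Mills mass gap.
-/

noncomputable section

namespace YMDAG.N18.KernelLettersJunctions

open scoped BigOperators
open Literature.MathematicalPhysics.QuantumFieldTheory.Balaban1983to89
open Literature.MathematicalPhysics.QuantumFieldTheory.Balaban1983to89.T4Continuum (T4Family ULoop)
open Literature.MathematicalPhysics.QuantumFieldTheory.Balaban1983to89.T4OutputRate (Window NE5 NE9 FadingMemory DecayBound)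
open Literature.MathematicalPhysics.QuantumFieldTheory.Balaban1983to89.T4CouplingMatching (ScaleShiftRate)
open Literature.MathematicalPhysics.QuantumFieldTheory.Balaban1983to89.B12Sec2to5 (l1 betaPrime510)
open Node00 (prependCoupling U3Letters₁₁ Stage13Params Stage13HParams TermFamily1 betaMerged)
open Node00.U3OfKernels (histPrefix kernelA objects objectsOfRecord₁₃ ne9_EA_iff decayBound_EA_iff)
open Node00.U3KernelLetters (KernelStepRate PolLimitsExist WindowedNE9 kernelStepRate_iff KernelStepRateOfRecord₁₃ PolLimitsExistOfRecord₁₃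
  WindowedNE9OfRecord₁₃)
open YMDAG.N22.AtKernels (ne9_EA_of_windowed decay510_kernelA_of_windowed)
open YMDAG.N18.AtU3OfKernels (kernelStepRate_family_of_member)
open YMDAG.N18.KernelStepRateBoxes (scaleShiftRate_betaMerged_of_n18At_objects_of_decayBound)
open YMDAG.N18.AtRecordOfKernelLetters (n18At_u3OfRecord₁₃_objects_iff_kernelStepRate_letter n18At_rateCarriers_of_kernels_pin_iff_letter)
open YMDAG.UVSplit

section Generic

variable {𝔄 : Type*} [NormedRing 𝔄] [NormedAlgebra ℝ 𝔄]
variable {V : Type*} [NormedAddCommGroup V] [NormedSpace ℝ V] {ι : Type*} [Fintype ι]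
variable (F : T4Family) (ℰ : TermFamily1 F 𝔄) (ρ : V →L[ℝ] 𝔄) (bV : Module.Basis ι ℝ V)

/-! ## §1 (J1) The N18 letter from ONE member and node N22's windowed letters -/

/-- **(J1) THE N18 LETTER FROM ONE MEMBER + N22's WINDOWED LETTERS.**  (1.21)-existence on the window (`PolLimitsExist`) and the windowed joint
history-Lipschitz bounds (`WindowedNE9`, moduli `Λ` of fading memory `C₉, ω`) give NE9 of run A's kernel functional (dag-n22-w3's passage); then the kernel step
rate at ONE member `b₀ ∈ ]0, γ]` with constant `C₅` (`0 ≤ ω ≤ θ ≤ 1`) gives the letter `KernelStepRate … γ κ θ (C₅ + C₉γ)` at EVERY member (this seat's family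
reduction). [cite: Balaban1987RG1, Thm 1 p.259, (1.21) p.264 and §5 p.298] -/
theorem kernelStepRate_of_member_of_windowedNE9 {γ κ C₉ ω θ C₅ : ℝ} {Λ : ℕ → ℕ → ℝ}
    (hlim : PolLimitsExist F ℰ ρ bV (Window γ)) (hK : WindowedNE9 F ℰ ρ bV (Window γ) κ Λ) (hΛ : FadingMemory C₉ ω Λ)
    (hω0 : 0 ≤ ω) (hωθ : ω ≤ θ) (hθ1 : θ ≤ 1) {b₀ : ℝ} (hb₀ : 0 < b₀) (hb₀γ : b₀ ≤ γ)
    (h5 : ∀ g ∈ Window γ, ∀ (k : ℕ) (μ ν : Fin 4) (z : Fin 4 → ℤ),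
      |kernelA F ℰ ρ bV g k μ ν z - kernelA F ℰ ρ bV (prependCoupling b₀ g) (k + 1) μ ν z| ≤ C₅ * θ ^ (k + 1) * Real.exp (-(κ * l1 z))) :
    KernelStepRate F ℰ ρ bV γ κ θ (C₅ + C₉ * γ) :=
  (kernelStepRate_iff F ℰ ρ bV γ κ θ _).2
    (kernelStepRate_family_of_member F ℰ ρ bV ((ne9_EA_iff F ℰ ρ bV _ κ Λ).1 (ne9_EA_of_windowed F ℰ ρ bV hlim hK)) hΛ hω0 hωθ hθ1
      hb₀ hb₀γ h5)

/-! ## §2 (J2) The N18 letter + a UNIFORM windowed (5.10) decay ⟹ node N17's scale-shift rate of the merged β -/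

/-- **NODE U3's DECAY SLOT FROM A UNIFORM WINDOWED (5.10) DECAY + (1.21)-EXISTENCE**: if the windowed finite-volume kernels of every level at every coupling
sequence of `W` are eventually `E₀·e^{−δ|z|₁}`-bounded with ONE constant `E₀` (the uniform form n17-a's `hU` needs — W1-19b's `WindowedDecay` has one constant
per sequence and does NOT give this), then `DecayBound (EA F ℰ ρ bV) W E₀ δ` (dag-n22-w3's `decay510_kernelA_of_windowed` per entry, W1-19's `decayBound_EA_iff`).
[cite: Balaban1987RG1, (1.18) p.263 and (5.10) p.293] -/
theorem decayBound_EA_of_windowedUniform {W : Set (ℕ → ℝ)} {E₀ δ : ℝ} (hlim : PolLimitsExist F ℰ ρ bV W)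
    (hKu : ∀ g ∈ W, ∀ (k : ℕ) (μ ν : Fin 4) (z : Fin 4 → ℤ), ∀ᶠ K in Filter.atTop,
      |Node00.polWindow F K (k + 1) (ℰ k (histPrefix g k) K) ρ bV μ ν z| ≤ E₀ * Real.exp (-δ * l1 z)) :
    DecayBound (Node00.U3OfKernels.EA F ℰ ρ bV) W E₀ δ :=
  (decayBound_EA_iff F ℰ ρ bV W E₀ δ).2 fun g hg k μ ν =>
    decay510_kernelA_of_windowed F ℰ ρ bV (hlim g hg k) (fun z => hKu g hg k μ ν z)

variable {N : ℕ} [NeZero N]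

/-- ★ **(J2) NODE N17's SCALE-SHIFT RATE OF THE MERGED β FROM THE N18 LETTER + A UNIFORM WINDOWED DECAY** (all letters at the kernel objects): `KernelStepRate …
θ.γ ℓ.κ ℓ.θ₅ ℓ.C₅` (the N18 slot, `…_iff_kernelStepRate_letter`), `0 < ℓ.κ`, (1.21)-existence on the window and a uniform windowed (5.10) decay at rate `δ > 0` give
`ScaleShiftRate (betaPrime510 4 (ℓ.C₅·ℓ.θ₅) ℓ.κ) ℓ.θ₅ θ.γ (betaMerged F ℰ ρ bV)` — this seat's `scaleShiftRate_betaMerged_of_n18At_objects_of_decayBound` (n17-a's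
kernel road inside). [cite: Balaban1987RG1, (1.18) p.263, (1.20)–(1.22) p.264 and (5.10) p.293] -/
theorem scaleShiftRate_betaMerged_of_kernelStepRate_of_windowedUniform (θ : Stage13Params F N) (ℓ : U3Letters₁₁)
    (h18 : KernelStepRate F ℰ ρ bV θ.γ ℓ.κ ℓ.θ₅ ℓ.C₅) (hκ : 0 < ℓ.κ) {E₀ δ : ℝ} (hδ : 0 < δ)
    (hlim : PolLimitsExist F ℰ ρ bV (Window θ.γ))
    (hKu : ∀ g ∈ Window θ.γ, ∀ (k : ℕ) (μ ν : Fin 4) (z : Fin 4 → ℤ), ∀ᶠ K in Filter.atTop,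
      |Node00.polWindow F K (k + 1) (ℰ k (histPrefix g k) K) ρ bV μ ν z| ≤ E₀ * Real.exp (-δ * l1 z)) :
    ScaleShiftRate (betaPrime510 4 (ℓ.C₅ * ℓ.θ₅) ℓ.κ) ℓ.θ₅ θ.γ (betaMerged F ℰ ρ bV) :=
  scaleShiftRate_betaMerged_of_n18At_objects_of_decayBound F ℰ ρ bV θ ℓ 0
    ((n18At_u3OfRecord₁₃_objects_iff_kernelStepRate_letter F ℰ ρ bV θ ℓ 0).2 h18) hκ hδ
    (decayBound_EA_of_windowedUniform F ℰ ρ bV hlim hKu)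

end Generic

/-! ## §3 At the record, Stage 13 (letters OF RECORD; the merged term family of record in the record's β-chart) and under the reading pin -/

section Record

open scoped Matrix.Norms.L2Operator

variable (F : T4Family) (N : ℕ) [NeZero N]

/-- **(J1) AT THE RECORD**: `PolLimitsExistOfRecord₁₃ F N θ`, `WindowedNE9OfRecord₁₃ F N θ ℓ.κ ℓ.moduli` (node N22's letters of record), the signs `ℓ.Signs`,
`ℓ.ω ≤ ℓ.θ₅`, and the kernel step rate of the merged term of record at ONE member `b₀ ∈ ]0, θ.γ]` with constant `ℓ.C₅ − ℓ.C₉·θ.γ` give the N18 letter of record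
`KernelStepRateOfRecord₁₃ F N θ ℓ.κ ℓ.θ₅ ℓ.C₅`. [cite: Balaban1987RG1, Thm 1 p.259, (1.21) p.264 and §5 p.298] -/
theorem kernelStepRateOfRecord₁₃_of_member_of_windowedNE9OfRecord₁₃ (θ : Stage13Params F N) (ℓ : U3Letters₁₁) (hs : ℓ.Signs)
    (hωθ : ℓ.ω ≤ ℓ.θ₅) (hlim : PolLimitsExistOfRecord₁₃ F N θ) (hK : WindowedNE9OfRecord₁₃ F N θ ℓ.κ ℓ.moduli) {b₀ : ℝ} (hb₀ : 0 < b₀)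
    (hb₀γ : b₀ ≤ θ.γ)
    (h5 : letI := θ.instVβ₁; letI := θ.instVβ₂; letI := θ.instιβ
      ∀ g ∈ Window θ.γ, ∀ (k : ℕ) (μ ν : Fin 4) (z : Fin 4 → ℤ),
        |kernelA F (Node00.mergedTermFamilyMatT F N (Node00.TβOfRecord₁₃ F N) (Node00.chiβOfRecord₁₃ F N θ) θ.εbg) θ.ρ8 θ.bV g k μ ν z -
            kernelA F (Node00.mergedTermFamilyMatT F N (Node00.TβOfRecord₁₃ F N) (Node00.chiβOfRecord₁₃ F N θ) θ.εbg) θ.ρ8 θ.bV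
              (prependCoupling b₀ g) (k + 1) μ ν z| ≤
          (ℓ.C₅ - ℓ.C₉ * θ.γ) * ℓ.θ₅ ^ (k + 1) * Real.exp (-(ℓ.κ * l1 z))) :
    KernelStepRateOfRecord₁₃ F N θ ℓ.κ ℓ.θ₅ ℓ.C₅ := by
  letI := θ.instVβ₁; letI := θ.instVβ₂; letI := θ.instιβ
  have h := kernelStepRate_of_member_of_windowedNE9 F _ θ.ρ8 θ.bV hlim hK (fun a i _ => ⟨hs.moduli_nonneg a i, le_rfl⟩)
    hs.ω_nonneg hωθ hs.θ₅_lt_one.le hb₀ hb₀γ h5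
  rw [sub_add_cancel] at h
  exact h

/-- **(J2) AT THE RECORD**: the N18 letter of record, `0 < ℓ.κ`, (1.21)-existence of record and a UNIFORM windowed (5.10) decay of the merged term of record
(rate `δ > 0`, ONE constant `E₀`) give node N17's scale-shift rate of the merged β of record
`ScaleShiftRate (betaPrime510 4 (ℓ.C₅·ℓ.θ₅) ℓ.κ) ℓ.θ₅ θ.γ (betaMerged F ℰ_rec θ.ρ8 θ.bV)`. [cite: Balaban1987RG1, (1.18) p.263, (1.20)–(1.22) p.264, (1.6) p.261] -/
theorem scaleShiftRate_betaMergedOfRecord_of_letters (θ : Stage13Params F N) (ℓ : U3Letters₁₁)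
    (h18 : KernelStepRateOfRecord₁₃ F N θ ℓ.κ ℓ.θ₅ ℓ.C₅) (hκ : 0 < ℓ.κ) {E₀ δ : ℝ} (hδ : 0 < δ) (hlim : PolLimitsExistOfRecord₁₃ F N θ)
    (hKu : letI := θ.instVβ₁; letI := θ.instVβ₂; letI := θ.instιβ
      ∀ g ∈ Window θ.γ, ∀ (k : ℕ) (μ ν : Fin 4) (z : Fin 4 → ℤ), ∀ᶠ K in Filter.atTop,
        |Node00.polWindow F K (k + 1)
            (Node00.mergedTermFamilyMatT F N (Node00.TβOfRecord₁₃ F N) (Node00.chiβOfRecord₁₃ F N θ) θ.εbg k (histPrefix g k) K) θ.ρ8 θ.bV μ ν z| ≤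
          E₀ * Real.exp (-δ * l1 z)) :
    letI := θ.instVβ₁; letI := θ.instVβ₂; letI := θ.instιβ
    ScaleShiftRate (betaPrime510 4 (ℓ.C₅ * ℓ.θ₅) ℓ.κ) ℓ.θ₅ θ.γ
      (betaMerged F (Node00.mergedTermFamilyMatT F N (Node00.TβOfRecord₁₃ F N) (Node00.chiβOfRecord₁₃ F N θ) θ.εbg) θ.ρ8 θ.bV) := by
  letI := θ.instVβ₁; letI := θ.instVβ₂; letI := θ.instιβ
  exact scaleShiftRate_betaMerged_of_kernelStepRate_of_windowedUniform F _ θ.ρ8 θ.bV θ ℓ h18 hκ hδ hlim hKu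

variable {N}

/-- **(J1) UNDER THE READING PIN** (K3⁷ v3 `U3PinnedKernels`, `ℓ := ℓ' F θ`): the N18 conjunct at EVERY run-length bundle of a pinned reading from ONE member +
node N22's letters of record (+ signs, `ℓ.ω ≤ ℓ.θ₅`). [cite: Balaban1987RG1, Thm 1 p.259 and §5 p.298] -/
theorem n18At_rateCarriers_of_kernels_pin_of_member_of_windowedNE9 (𝔯 : RateReading₁₃CoPH N) (θ : Stage13HParams F N)
    (hP : θ.Provisos₁₃CoPH F N) (g₀ : ℕ → ℝ) (os : List (ULoop F)) (ℓ : U3Letters₁₁)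
    (hpin : (𝔯.lit F θ hP g₀ os).u3 = objectsOfRecord₁₃ F N θ.toStage13Params ℓ) (k : ℕ) (hs : ℓ.Signs) (hωθ : ℓ.ω ≤ ℓ.θ₅)
    (hlim : PolLimitsExistOfRecord₁₃ F N θ.toStage13Params) (hK : WindowedNE9OfRecord₁₃ F N θ.toStage13Params ℓ.κ ℓ.moduli)
    {b₀ : ℝ} (hb₀ : 0 < b₀) (hb₀γ : b₀ ≤ θ.γ)
    (h5 : letI := θ.instVβ₁; letI := θ.instVβ₂; letI := θ.instιβ
      ∀ g ∈ Window θ.γ, ∀ (k : ℕ) (μ ν : Fin 4) (z : Fin 4 → ℤ),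
        |kernelA F (Node00.mergedTermFamilyMatT F N (Node00.TβOfRecord₁₃ F N) (Node00.chiβOfRecord₁₃ F N θ.toStage13Params) θ.εbg) θ.ρ8 θ.bV
              g k μ ν z -
            kernelA F (Node00.mergedTermFamilyMatT F N (Node00.TβOfRecord₁₃ F N) (Node00.chiβOfRecord₁₃ F N θ.toStage13Params) θ.εbg) θ.ρ8 θ.bV
              (prependCoupling b₀ g) (k + 1) μ ν z| ≤
          (ℓ.C₅ - ℓ.C₉ * θ.γ) * ℓ.θ₅ ^ (k + 1) * Real.exp (-(ℓ.κ * l1 z))) :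
    N18At (rateCarriersOfRecord₁₃CoPH 𝔯 F θ hP g₀ os k).u3 :=
  (n18At_rateCarriers_of_kernels_pin_iff_letter F 𝔯 θ hP g₀ os ℓ hpin k).2
    (kernelStepRateOfRecord₁₃_of_member_of_windowedNE9OfRecord₁₃ F N θ.toStage13Params ℓ hs hωθ hlim hK hb₀ hb₀γ h5)

end Record

end YMDAG.N18.KernelLettersJunctions

end
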